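import Summits.NavierStokesRegularity.NavierStokesRegularity.Theorems.AxisTwistDoorAveragedConeLiouvilleNUStandingTools
import HarnessLib

/-!
# N4 piece P4b (N-W′): classical data on `]0,T[ × B(0,1)` ⇒ the axis-free standing hypotheses
# `NUStanding` on every admissible frame — `stub_standing_of_classical : Sig.nu_standing_of_classical`

Route `AxisTwistDoor`, crux `AveragedConeLiouville` (stmt-NavierStokesRegularity-26889), INPUT N4
(Nazarov–Ural'tseva 2011 §3 = Lei–Ren–Tian 2025 Lemma 2.5), cut of record pub/ns-inputs STATUS
2026-08-28T11:29:42Z, texts `kits/N4-skeleton.lean` (5372b51f971b2f9d): this file lands the text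
`Sig.nu_standing_of_classical` VERBATIM as `nu_standing_of_classical`.

CONSTRUCTION. Given the classical data `(V, b)` on the open cylinder `]0,T[ × B(0,1)` (`V ∈ C²`,
`b ∈ C¹`, `|b| ≤ Λ`, `div b = 0`, `V ≥ 0`, `∂ₜV − ΔV + ⟪b,∇V⟫ ≥ 0`), a level cap `k > 0`, a
switch-on time `t⋆ ∈ ]0,τ[`, a frame top `τ ≤ T` and a frame scale `R` with `2R < 1`:
* `ψ(s) = smoothTransition(2s/t⋆ − 1)` (smooth, monotone, `= 0` for `s ≤ t⋆/2`, `= 1` for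
  `s ≥ t⋆`), `ψ₁(s) = smoothTransition(4s/t⋆ − 1)` (`= 1` for `s ≥ t⋆/2`), `χ` a smooth bump `= 1` on
  `B̄(0,R')`, supported in `B(0,(R'+1)/2)`, `R' = (2R+1)/2`;
* `Φ(t,x) = χ(x) ψ(t+τ) V(t+τ,x)` for `t < 0` (`0` for `t ≥ 0`), `U(t,x) = ψ₁(t+τ) b(t+τ,x)` on
  `{t < 0} × B(0,1)` (`0` elsewhere).
`ψV` is again a classical supersolution with drift `ψ₁ b` (where `ψ > 0` one has `ψ₁ = 1`, and
`ψ'V ≥ 0`); it vanishes for `t + τ ≤ t⋆/2`, so the frame `]-R², 0[ × B(0,2R)` may hang below the data;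
the energy class on the frame is `nuEnergyClass_of_supersolution` (`…NUEnergyClass`, frame ball
`B(0,R')`); the drift class holds with `N = ((Λ³|B₁|)^{4/3})` since `|U| ≤ Λ` and `2R < 1`.

WHAT THIS IS NOT: not a statement about Navier–Stokes; N4 is an INPUT; item 26889 and the summit
stay open. [cite: NazarovUraltseva2011HarnackDivFree, §3 (arXiv:1011.1888 p. 8)] [cite: LeiRenTian2025, Lemma 2.5]
-/

noncomputable section

-- the summit and its single sub-problem share the name (CONVENTIONS §1)
set_option linter.dupNamespace false

open MeasureTheory Set Function Filter Topology Metric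
open scoped NNReal ENNReal InnerProductSpace RealInnerProductSpace Laplacian
open Literature.Analysis Literature.Analysis.FluidPDE

namespace Summit.NavierStokesRegularity.NavierStokesRegularity.Theorems.AveragedConeLiouville.NUPositivity

/-! ### The standing hypotheses from classical data -/

/-- **N-W′ = `Sig.nu_standing_of_classical` (text of record, `kits/N4-skeleton.lean`).** For a drift
bound `Λ ≥ 0` there is a drift constant `N` such that classical data on `]0,T[ × B(0,1)` can be put
into every admissible frame: for `k > 0`, `0 < t⋆ < τ ≤ T`, `0 < R`, `2R < 1` there are `Φ, U` with
`NUStanding Φ U k R N` and `Φ(t,x) = V(t+τ,x)` for `t⋆ ≤ t+τ`, `t < 0`, `x ∈ B(0,2R)` (module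
docstring for the construction). [cite: NazarovUraltseva2011HarnackDivFree, §3 (arXiv:1011.1888 p. 8)] -/
theorem nu_standing_of_classical :
    ∀ (Λ : ℝ), 0 ≤ Λ → ∃ N : ℝ≥0,
    ∀ (T : ℝ) (V : ℝ → EuclideanSpace ℝ (Fin 3) → ℝ)
      (b : ℝ → EuclideanSpace ℝ (Fin 3) → EuclideanSpace ℝ (Fin 3)),
      ContDiffOn ℝ 2 (uncurry V) (Ioo 0 T ×ˢ ball (0 : EuclideanSpace ℝ (Fin 3)) 1) →
      ContDiffOn ℝ 1 (uncurry b) (Ioo 0 T ×ˢ ball (0 : EuclideanSpace ℝ (Fin 3)) 1) →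
      (∀ t ∈ Ioo 0 T, ∀ x ∈ ball (0 : EuclideanSpace ℝ (Fin 3)) 1, ‖b t x‖ ≤ Λ) →
      (∀ t ∈ Ioo 0 T, ∀ x ∈ ball (0 : EuclideanSpace ℝ (Fin 3)) 1,
          VectorCalculus.divergence (b t) x = 0) →
      (∀ t ∈ Ioo 0 T, ∀ x ∈ ball (0 : EuclideanSpace ℝ (Fin 3)) 1, 0 ≤ V t x) →
      (∀ t ∈ Ioo 0 T, ∀ x ∈ ball (0 : EuclideanSpace ℝ (Fin 3)) 1,
          0 ≤ deriv (fun s => V s x) t - (Δ (V t)) x + ⟪b t x, gradient (V t) x⟫_ℝ) →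
    ∀ (k tstar τ R : ℝ), 0 < k → 0 < tstar → tstar < τ → τ ≤ T → 0 < R → 2 * R < 1 →
      ∃ (Φ : ℝ → EuclideanSpace ℝ (Fin 3) → ℝ)
        (U : ℝ → EuclideanSpace ℝ (Fin 3) → EuclideanSpace ℝ (Fin 3)),
        NUStanding Φ U k R N ∧
        ∀ t x, tstar ≤ t + τ → t < 0 → x ∈ ball (0 : EuclideanSpace ℝ (Fin 3)) (2 * R) →
          Φ t x = V (t + τ) x := by
  intro Λ hΛ
  set C₀ : ℝ≥0∞ := ENNReal.ofReal Λ ^ (3 : ℕ) * volume (ball (0 : EuclideanSpace ℝ (Fin 3)) 1) with hC₀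
  have hC₀top : C₀ ≠ ⊤ := ENNReal.mul_ne_top (ENNReal.pow_ne_top ENNReal.ofReal_ne_top)
    measure_ball_lt_top.ne
  have hC₀' : C₀ ^ (4 / 3 : ℝ) ≠ ⊤ := ENNReal.rpow_ne_top_of_nonneg (by norm_num) hC₀top
  refine ⟨(C₀ ^ (4 / 3 : ℝ)).toNNReal, ?_⟩
  intro T V b hV2 hb1 hbΛ hbdiv hV0 hsupV k tstar τ R hk htstar htτ hτT hR h2R
  have ha : 0 < tstar / 2 := by positivity
  have ha' : 0 < tstar / 4 := by positivity
  set ψ : ℝ → ℝ := fun s => Real.smoothTransition (s / (tstar / 2) - 1) with hψ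
  set ψ₁ : ℝ → ℝ := fun s => Real.smoothTransition (s / (tstar / 4) - 1) with hψ₁
  have hψ2 : ContDiff ℝ 2 ψ := (timeCutoff_props ha).1
  have hψ01 : ∀ s, 0 ≤ ψ s ∧ ψ s ≤ 1 := (timeCutoff_props ha).2.1
  have hψ0 : ∀ s, s ≤ tstar / 2 → ψ s = 0 := (timeCutoff_props ha).2.2.1
  have hψ1 : ∀ s, tstar ≤ s → ψ s = 1 := fun s hs => (timeCutoff_props ha).2.2.2.1 s (by linarith)
  have hψ' : ∀ s, 0 ≤ deriv ψ s := (timeCutoff_props ha).2.2.2.2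
  have hφ2 : ContDiff ℝ 2 ψ₁ := (timeCutoff_props ha').1
  have hφ01 : ∀ s, 0 ≤ ψ₁ s ∧ ψ₁ s ≤ 1 := (timeCutoff_props ha').2.1
  have hφ0 : ∀ s, s ≤ tstar / 4 → ψ₁ s = 0 := (timeCutoff_props ha').2.2.1
  have hφ1 : ∀ s, tstar / 2 ≤ s → ψ₁ s = 1 := fun s hs => (timeCutoff_props ha').2.2.2.1 s (by linarith)
  set R' : ℝ := (2 * R + 1) / 2 with hR'
  have h2RR' : 2 * R < R' := by rw [hR']; linarith
  have hR'1 : R' < 1 := by rw [hR']; linarith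
  have hR'pos : 0 < R' := by linarith
  let χb : ContDiffBump (0 : EuclideanSpace ℝ (Fin 3)) :=
    ⟨R', (R' + 1) / 2, hR'pos, by linarith⟩
  set χ : EuclideanSpace ℝ (Fin 3) → ℝ := fun x => χb x with hχ
  have hχ1 : ∀ x ∈ closedBall (0 : EuclideanSpace ℝ (Fin 3)) R', χ x = 1 := fun x hx =>
    χb.one_of_mem_closedBall hx
  have hχsupp : tsupport χ = closedBall (0 : EuclideanSpace ℝ (Fin 3)) ((R' + 1) / 2) := χb.tsupport_eq
  have hχball : tsupport χ ⊆ ball (0 : EuclideanSpace ℝ (Fin 3)) 1 := by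
    rw [hχsupp]; exact closedBall_subset_ball (by linarith)
  have hχ01 : ∀ x, 0 ≤ χ x ∧ χ x ≤ 1 := fun x => ⟨χb.nonneg, χb.le_one⟩
  have hχsm : ContDiff ℝ 2 χ := χb.contDiff
  set f : ℝ × EuclideanSpace ℝ (Fin 3) → ℝ := fun z => χ z.2 * (ψ (z.1 + τ) * V (z.1 + τ) z.2) with hf
  set Φ : ℝ → EuclideanSpace ℝ (Fin 3) → ℝ := fun t x => if t < 0 then f (t, x) else 0 with hΦ
  set U : ℝ → EuclideanSpace ℝ (Fin 3) → EuclideanSpace ℝ (Fin 3) := fun t x =>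
    if t < 0 ∧ ‖x‖ < 1 then ψ₁ (t + τ) • b (t + τ) x else 0 with hU
  refine ⟨Φ, U, ?_, ?_⟩
  swap
  · -- identification
    intro t x htt ht hx
    have hx' : x ∈ closedBall (0 : EuclideanSpace ℝ (Fin 3)) R' :=
      ball_subset_closedBall (ball_subset_ball h2RR'.le hx)
    have e1 : Φ t x = χ x * (ψ (t + τ) * V (t + τ) x) := by simp only [hΦ, hf, if_pos ht]
    rw [e1, hχ1 x hx', hψ1 (t + τ) htt]
    ring
  have hcylopen : IsOpen (Ioo 0 T ×ˢ ball (0 : EuclideanSpace ℝ (Fin 3)) 1) := isOpen_Ioo.prod isOpen_ball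
  have hAopen : IsOpen {z : ℝ × EuclideanSpace ℝ (Fin 3) | z.1 < 0} := isOpen_lt continuous_fst continuous_const
  have hshift : Continuous (fun z : ℝ × EuclideanSpace ℝ (Fin 3) => (z.1 + τ, z.2)) :=
    (continuous_fst.add continuous_const).prodMk continuous_snd
  have hshift2 : ContDiff ℝ 2 (fun z : ℝ × EuclideanSpace ℝ (Fin 3) => (z.1 + τ, z.2)) :=
    (contDiff_fst.add contDiff_const).prodMk contDiff_snd
  have hχ0 : ∀ x, x ∉ ball (0 : EuclideanSpace ℝ (Fin 3)) 1 → χ x = 0 := fun x hx =>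
    image_eq_zero_of_notMem_tsupport fun h => hx (hχball h)
  have hψev : ∀ z : ℝ × EuclideanSpace ℝ (Fin 3), z.1 + τ < tstar / 2 →
      ∀ᶠ w in 𝓝 z, ψ (w.1 + τ) = 0 := by
    intro z hz
    have ho : IsOpen {w : ℝ × EuclideanSpace ℝ (Fin 3) | w.1 + τ < tstar / 2} :=
      isOpen_lt (continuous_fst.add continuous_const) continuous_const
    filter_upwards [ho.mem_nhds hz] with w hw using hψ0 _ (le_of_lt hw)
  have hφev : ∀ z : ℝ × EuclideanSpace ℝ (Fin 3), z.1 + τ < tstar / 4 →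
      ∀ᶠ w in 𝓝 z, ψ₁ (w.1 + τ) = 0 := by
    intro z hz
    have ho : IsOpen {w : ℝ × EuclideanSpace ℝ (Fin 3) | w.1 + τ < tstar / 4} :=
      isOpen_lt (continuous_fst.add continuous_const) continuous_const
    filter_upwards [ho.mem_nhds hz] with w hw using hφ0 _ (le_of_lt hw)
  have hVat : ∀ z : ℝ × EuclideanSpace ℝ (Fin 3), 0 < z.1 + τ → z.1 < 0 → z.2 ∈ ball (0 : EuclideanSpace ℝ (Fin 3)) 1 →
      ContinuousAt (fun w : ℝ × EuclideanSpace ℝ (Fin 3) => V (w.1 + τ) w.2) z := by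
    intro z h1 h2 h3
    have hmem : (z.1 + τ, z.2) ∈ Ioo 0 T ×ˢ ball (0 : EuclideanSpace ℝ (Fin 3)) 1 :=
      ⟨⟨h1, by linarith⟩, h3⟩
    exact ContinuousAt.comp (g := uncurry V) (f := fun w : ℝ × EuclideanSpace ℝ (Fin 3) => (w.1 + τ, w.2))
      (x := z) (hV2.continuousOn.continuousAt (hcylopen.mem_nhds hmem)) hshift.continuousAt
  have hbat : ∀ z : ℝ × EuclideanSpace ℝ (Fin 3), 0 < z.1 + τ → z.1 < 0 → z.2 ∈ ball (0 : EuclideanSpace ℝ (Fin 3)) 1 →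
      ContinuousAt (fun w : ℝ × EuclideanSpace ℝ (Fin 3) => b (w.1 + τ) w.2) z := by
    intro z h1 h2 h3
    have hmem : (z.1 + τ, z.2) ∈ Ioo 0 T ×ˢ ball (0 : EuclideanSpace ℝ (Fin 3)) 1 :=
      ⟨⟨h1, by linarith⟩, h3⟩
    exact ContinuousAt.comp (g := uncurry b) (f := fun w : ℝ × EuclideanSpace ℝ (Fin 3) => (w.1 + τ, w.2))
      (x := z) (hb1.continuousOn.continuousAt (hcylopen.mem_nhds hmem)) hshift.continuousAt
  have hfat : ∀ z : ℝ × EuclideanSpace ℝ (Fin 3), z.1 < 0 → ContinuousAt f z := by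
    intro z hz
    by_cases hA : z.1 + τ < tstar / 2
    · have hev : f =ᶠ[𝓝 z] fun _ => 0 := by
        filter_upwards [hψev z hA] with w hw
        simp only [hf, hw, zero_mul, mul_zero]
      exact (continuousAt_const.congr_of_eventuallyEq hev)
    · by_cases hB : z.2 ∈ ball (0 : EuclideanSpace ℝ (Fin 3)) 1
      · have h1 : 0 < z.1 + τ := by linarith [not_lt.mp hA]
        exact (hχsm.continuous.continuousAt.comp continuousAt_snd).mul
          (((hψ2.continuous.comp (continuous_fst.add continuous_const)).continuousAt).mul
            (hVat z h1 hz hB))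
      · have hχz : z.2 ∉ tsupport χ := fun h => hB (hχball h)
        have hev0 : ∀ᶠ w in 𝓝 z, χ w.2 = 0 :=
          (continuous_snd.tendsto z).eventually (notMem_tsupport_iff_eventuallyEq.mp hχz)
        have hev : f =ᶠ[𝓝 z] fun _ => 0 := by
          filter_upwards [hev0] with w hw
          simp only [hf, hw, zero_mul]
        exact (continuousAt_const.congr_of_eventuallyEq hev)
  have hfcont : ContinuousOn f {z : ℝ × EuclideanSpace ℝ (Fin 3) | z.1 < 0} := fun z hz =>
    (hfat z hz).continuousWithinAt
  have hΦf : ∀ z : ℝ × EuclideanSpace ℝ (Fin 3), z.1 < 0 → uncurry Φ z = f z := fun z hz => by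
    simp only [uncurry, hΦ, if_pos hz]
  have hΦcont : ContinuousOn (uncurry Φ) {z : ℝ × EuclideanSpace ℝ (Fin 3) | z.1 < 0} :=
    hfcont.congr fun z hz => hΦf z hz
  have hΦmeas : Measurable (uncurry Φ) :=
    measurable_of_continuousOn_of_eq_zero hAopen hΦcont fun z hz => by
      simp only [uncurry, hΦ, if_neg (show ¬ z.1 < 0 from hz)]
  set g : ℝ × EuclideanSpace ℝ (Fin 3) → EuclideanSpace ℝ (Fin 3) := fun z => ψ₁ (z.1 + τ) • b (z.1 + τ) z.2
    with hg
  have hAUopen : IsOpen {z : ℝ × EuclideanSpace ℝ (Fin 3) | z.1 < 0 ∧ ‖z.2‖ < 1} :=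
    (isOpen_lt continuous_fst continuous_const).inter (isOpen_lt (continuous_norm.comp continuous_snd)
      continuous_const)
  have hgat : ∀ z : ℝ × EuclideanSpace ℝ (Fin 3), z.1 < 0 → ‖z.2‖ < 1 → ContinuousAt g z := by
    intro z hz1 hz2
    by_cases hA : z.1 + τ < tstar / 4
    · have hev : g =ᶠ[𝓝 z] fun _ => 0 := by
        filter_upwards [hφev z hA] with w hw
        simp only [hg, hw, zero_smul]
      exact (continuousAt_const.congr_of_eventuallyEq hev)
    · have h1 : 0 < z.1 + τ := by linarith [not_lt.mp hA]
      exact ((hφ2.continuous.comp (continuous_fst.add continuous_const)).continuousAt).smul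
        (hbat z h1 hz1 (mem_ball_zero_iff.2 hz2))
  have hUg : ∀ z : ℝ × EuclideanSpace ℝ (Fin 3), z.1 < 0 ∧ ‖z.2‖ < 1 → uncurry U z = g z := fun z hz => by
    simp only [uncurry, hU, if_pos hz, hg]
  have hgcont : ContinuousOn g {z : ℝ × EuclideanSpace ℝ (Fin 3) | z.1 < 0 ∧ ‖z.2‖ < 1} :=
    fun z hz => (hgat z hz.1 hz.2).continuousWithinAt
  have hUcont : ContinuousOn (uncurry U) {z : ℝ × EuclideanSpace ℝ (Fin 3) | z.1 < 0 ∧ ‖z.2‖ < 1} :=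
    hgcont.congr fun z hz => hUg z hz
  have hUmeas : AEStronglyMeasurable (uncurry U) volume :=
    (measurable_of_continuousOn_of_eq_zero hAUopen hUcont fun z hz => by
      simp only [uncurry, hU, if_neg (show ¬ (z.1 < 0 ∧ ‖z.2‖ < 1) from hz)]).aestronglyMeasurable
  have hUbd : ∀ t x, ‖U t x‖ ≤ Λ := by
    intro t x
    by_cases h : t < 0 ∧ ‖x‖ < 1
    · simp only [hU, if_pos h]
      by_cases hs : 0 < t + τ
      · rw [norm_smul, Real.norm_eq_abs, abs_of_nonneg (hφ01 _).1]
        calc ψ₁ (t + τ) * ‖b (t + τ) x‖ ≤ 1 * Λ :=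
            mul_le_mul (hφ01 _).2 (hbΛ _ ⟨hs, by linarith [h.1]⟩ x (mem_ball_zero_iff.2 h.2))
              (norm_nonneg _) zero_le_one
          _ = Λ := one_mul Λ
      · rw [hφ0 _ (by linarith [not_lt.mp hs]), zero_smul, norm_zero]; exact hΛ
    · simp only [hU, if_neg h, norm_zero]; exact hΛ
  have hΦ0 : ∀ t x, 0 ≤ Φ t x := by
    intro t x
    by_cases ht : t < 0
    · simp only [hΦ, if_pos ht, hf]
      by_cases hx : x ∈ ball (0 : EuclideanSpace ℝ (Fin 3)) 1
      · by_cases hs : 0 < t + τ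
        · exact mul_nonneg (hχ01 x).1 (mul_nonneg (hψ01 _).1 (hV0 _ ⟨hs, by linarith⟩ x hx))
        · rw [hψ0 _ (by linarith [not_lt.mp hs]), zero_mul, mul_zero]
      · rw [hχ0 x hx, zero_mul]
    · simp only [hΦ, if_neg ht]; exact le_rfl
  have hVslice : ∀ s ∈ Ioo 0 T, ContDiffOn ℝ 2 (V s) (ball (0 : EuclideanSpace ℝ (Fin 3)) 1) :=
    fun s hs x hx => (contDiffAt_slice_of_contDiffOn hcylopen hV2 (z := (s, x)) ⟨hs, hx⟩).contDiffWithinAt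
  have hslice : ∀ t, t < 0 → ContDiff ℝ 1 (Φ t) := by
    intro t ht
    by_cases hs : t + τ ≤ tstar / 2
    · have e : Φ t = fun _ => 0 := by
        funext x; simp only [hΦ, if_pos ht, hf, hψ0 _ hs, zero_mul, mul_zero]
      rw [e]; exact contDiff_const
    · have hs' := not_le.mp hs
      have hmem : t + τ ∈ Ioo 0 T := ⟨by linarith, by linarith⟩
      have e : Φ t = fun x => χ x * (ψ (t + τ) * V (t + τ) x) := by
        funext x; simp only [hΦ, if_pos ht, hf]
      rw [e]
      exact contDiff_mul_of_contDiffOn_of_tsupport_subset isOpen_ball (hχsm.of_le one_le_two) hχball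
        ((contDiffOn_const.mul ((hVslice _ hmem).of_le one_le_two)))
  -- the drift class
  have hinner : ∀ s, (∫⁻ y in ball (0 : EuclideanSpace ℝ (Fin 3)) (2 * R), ‖U s y‖ₑ ^ (3 : ℕ)) ≤ C₀ := by
    intro s
    calc (∫⁻ y in ball (0 : EuclideanSpace ℝ (Fin 3)) (2 * R), ‖U s y‖ₑ ^ (3 : ℕ))
        ≤ ∫⁻ _ in ball (0 : EuclideanSpace ℝ (Fin 3)) (2 * R), ENNReal.ofReal Λ ^ (3 : ℕ) :=
          setLIntegral_mono measurable_const fun y _ => by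
            have h2 : ‖U s y‖ₑ ≤ ENNReal.ofReal Λ := by
              rw [← ofReal_norm]; exact ENNReal.ofReal_le_ofReal (hUbd s y)
            exact pow_le_pow_left' h2 3
      _ = ENNReal.ofReal Λ ^ (3 : ℕ) * volume (ball (0 : EuclideanSpace ℝ (Fin 3)) (2 * R)) :=
          setLIntegral_const _ _
      _ ≤ ENNReal.ofReal Λ ^ (3 : ℕ) * volume (ball (0 : EuclideanSpace ℝ (Fin 3)) 1) :=
          by gcongr
  have hdriftclass : (∫⁻ s in Ioo (-R ^ 2) 0, (∫⁻ y in ball (0 : EuclideanSpace ℝ (Fin 3)) (2 * R),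
      ‖U s y‖ₑ ^ (3 : ℕ)) ^ (4 / 3 : ℝ)) ≤ ((C₀ ^ (4 / 3 : ℝ)).toNNReal : ℝ≥0∞) * ENNReal.ofReal R ^ 2 := by
    calc (∫⁻ s in Ioo (-R ^ 2) 0, (∫⁻ y in ball (0 : EuclideanSpace ℝ (Fin 3)) (2 * R),
          ‖U s y‖ₑ ^ (3 : ℕ)) ^ (4 / 3 : ℝ))
        ≤ ∫⁻ _ in Ioo (-R ^ 2) 0, C₀ ^ (4 / 3 : ℝ) :=
          setLIntegral_mono measurable_const fun s _ => ENNReal.rpow_le_rpow (hinner s) (by norm_num)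
      _ = C₀ ^ (4 / 3 : ℝ) * volume (Ioo (-R ^ 2) (0 : ℝ)) := setLIntegral_const _ _
      _ = ((C₀ ^ (4 / 3 : ℝ)).toNNReal : ℝ≥0∞) * ENNReal.ofReal R ^ 2 := by
          rw [ENNReal.coe_toNNReal hC₀', Real.volume_Ioo, ← ENNReal.ofReal_pow hR.le]
          congr 2
          ring
  -- the energy class on the frame `]-R², 0[ × B(0, R')`
  set S' : Set (ℝ × EuclideanSpace ℝ (Fin 3)) := Ioo (-R ^ 2) 0 ×ˢ ball (0 : EuclideanSpace ℝ (Fin 3)) R'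
    with hS'
  have hS'open : IsOpen S' := isOpen_Ioo.prod isOpen_ball
  have hS'1 : ∀ z ∈ S', z.1 < 0 := fun z hz => hz.1.2
  have hS'x : ∀ z ∈ S', z.2 ∈ ball (0 : EuclideanSpace ℝ (Fin 3)) 1 := fun z hz =>
    ball_subset_ball hR'1.le hz.2
  have hS'χ : ∀ z ∈ S', χ z.2 = 1 := fun z hz => hχ1 z.2 (ball_subset_closedBall hz.2)
  have hS'cyl : ∀ z ∈ S', 0 < z.1 + τ → (z.1 + τ, z.2) ∈ Ioo 0 T ×ˢ ball (0 : EuclideanSpace ℝ (Fin 3)) 1 :=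
    fun z hz h => ⟨⟨h, by linarith [hS'1 z hz]⟩, hS'x z hz⟩
  -- `Φ = ψV`, `U = ψ₁ b` on the frame
  set g₀ : ℝ × EuclideanSpace ℝ (Fin 3) → ℝ := fun z => ψ (z.1 + τ) * V (z.1 + τ) z.2 with hg₀
  have hΦg₀ : ∀ z ∈ S', uncurry Φ z = g₀ z := fun z hz => by
    rw [hΦf z (hS'1 z hz)]
    simp only [hf, hg₀, hS'χ z hz, one_mul]
  have hUg' : ∀ z ∈ S', uncurry U z = g z := fun z hz =>
    hUg z ⟨hS'1 z hz, mem_ball_zero_iff.1 (hS'x z hz)⟩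
  have hΦ2' : ContDiffOn ℝ 2 (uncurry Φ) S' := by
    refine ContDiffOn.congr ?_ hΦg₀
    refine contDiffOn_of_locally_contDiffOn fun z hz => ?_
    by_cases hs : 0 < z.1 + τ
    · refine ⟨{w | 0 < w.1 + τ}, isOpen_lt continuous_const (continuous_fst.add continuous_const), hs, ?_⟩
      have h1 : ContDiffOn ℝ 2 (fun w : ℝ × EuclideanSpace ℝ (Fin 3) => V (w.1 + τ) w.2)
          (S' ∩ {w | 0 < w.1 + τ}) :=
        hV2.comp hshift2.contDiffOn fun w hw => hS'cyl w hw.1 hw.2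
      exact ((hψ2.comp (contDiff_fst.add contDiff_const)).contDiffOn).mul h1
    · refine ⟨{w | w.1 + τ < tstar / 2}, isOpen_lt (continuous_fst.add continuous_const) continuous_const,
        by show z.1 + τ < tstar / 2; linarith [not_lt.mp hs], ?_⟩
      refine (contDiffOn_const (c := (0 : ℝ))).congr fun w hw => ?_
      show g₀ w = 0
      simp only [hg₀, hψ0 _ (le_of_lt hw.2), zero_mul]
  have hU1' : ContDiffOn ℝ 1 (uncurry U) S' := by
    refine ContDiffOn.congr ?_ hUg'
    refine contDiffOn_of_locally_contDiffOn fun z hz => ?_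
    by_cases hs : 0 < z.1 + τ
    · refine ⟨{w | 0 < w.1 + τ}, isOpen_lt continuous_const (continuous_fst.add continuous_const), hs, ?_⟩
      have h1 : ContDiffOn ℝ 1 (fun w : ℝ × EuclideanSpace ℝ (Fin 3) => b (w.1 + τ) w.2)
          (S' ∩ {w | 0 < w.1 + τ}) :=
        hb1.comp (hshift2.of_le (by norm_num)).contDiffOn fun w hw => hS'cyl w hw.1 hw.2
      exact (((hφ2.of_le (by norm_num)).comp (contDiff_fst.add contDiff_const)).contDiffOn).smul h1
    · refine ⟨{w | w.1 + τ < tstar / 4}, isOpen_lt (continuous_fst.add continuous_const) continuous_const,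
        by show z.1 + τ < tstar / 4; linarith [not_lt.mp hs], ?_⟩
      refine (contDiffOn_const (c := (0 : EuclideanSpace ℝ (Fin 3)))).congr fun w hw => ?_
      show g w = 0
      simp only [hg, hφ0 _ (le_of_lt hw.2), zero_smul]
  have hUΛ' : ∀ z ∈ S', ‖U z.1 z.2‖ ≤ Λ := fun z _ => hUbd z.1 z.2
  -- the drift is divergence free on the frame
  have hUev : ∀ z ∈ S', U z.1 =ᶠ[𝓝 z.2] fun x => ψ₁ (z.1 + τ) • b (z.1 + τ) x := by
    intro z hz
    have ho : IsOpen {x : EuclideanSpace ℝ (Fin 3) | ‖x‖ < 1} := isOpen_lt continuous_norm continuous_const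
    filter_upwards [ho.mem_nhds (mem_ball_zero_iff.1 (hS'x z hz))] with x hx
    have hc : z.1 < 0 ∧ ‖x‖ < 1 := ⟨hS'1 z hz, hx⟩
    simp only [hU, if_pos hc]
  have hdiv' : ∀ z ∈ S', VectorCalculus.divergence (U z.1) z.2 = 0 := by
    intro z hz
    unfold VectorCalculus.divergence
    by_cases hs : 0 < z.1 + τ
    · have hmem := hS'cyl z hz hs
      have hbd : DifferentiableAt ℝ (b (z.1 + τ)) z.2 :=
        (contDiffAt_slice_of_contDiffOn hcylopen hb1 (z := (z.1 + τ, z.2)) hmem).differentiableAt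
          one_ne_zero
      have e : (fun x => ψ₁ (z.1 + τ) • b (z.1 + τ) x) = ψ₁ (z.1 + τ) • b (z.1 + τ) := rfl
      rw [(hUev z hz).fderiv_eq, e, fderiv_const_smul hbd]
      have h0 := hbdiv (z.1 + τ) hmem.1 z.2 hmem.2
      unfold VectorCalculus.divergence at h0
      rw [ContinuousLinearMap.toLinearMap_smul, map_smul, h0, smul_zero]
    · have hev : U z.1 =ᶠ[𝓝 z.2] fun _ => (0 : EuclideanSpace ℝ (Fin 3)) := by
        filter_upwards [hUev z hz] with x hx
        rw [hx, hφ0 _ (by linarith [not_lt.mp hs]), zero_smul]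
      rw [hev.fderiv_eq, fderiv_const_apply, ContinuousLinearMap.toLinearMap_zero, map_zero]
  -- the supersolution inequality on the frame
  have hsup' : ∀ z ∈ S', 0 ≤ deriv (fun r => Φ r z.2) z.1 + fderiv ℝ (Φ z.1) z.2 (U z.1 z.2) -
      (Δ (Φ z.1)) z.2 := by
    intro z hz
    have hz1 := hS'1 z hz
    -- local forms of `Φ` near `z.2` (fixed time) and near `z.1` (fixed point)
    have hevx : Φ z.1 =ᶠ[𝓝 z.2] fun y => ψ (z.1 + τ) * V (z.1 + τ) y := by
      filter_upwards [isOpen_ball.mem_nhds hz.2] with y hy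
      have : χ y = 1 := hχ1 y (ball_subset_closedBall hy)
      simp only [hΦ, if_pos hz1, hf, this, one_mul]
    have hevt : (fun r => Φ r z.2) =ᶠ[𝓝 z.1] fun r => ψ (r + τ) * V (r + τ) z.2 := by
      filter_upwards [(isOpen_lt continuous_id continuous_const).mem_nhds hz1] with r hr
      have : χ z.2 = 1 := hS'χ z hz
      simp only [hΦ, if_pos (show r < 0 from hr), hf, this, one_mul]
    rw [hevt.deriv_eq, hevx.fderiv_eq, (InnerProductSpace.laplacian_congr_nhds hevx).eq_of_nhds]
    by_cases hs : z.1 + τ < tstar / 2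
    · -- everything vanishes
      have hψz : ψ (z.1 + τ) = 0 := hψ0 _ hs.le
      have hevt0 : (fun r => ψ (r + τ) * V (r + τ) z.2) =ᶠ[𝓝 z.1] fun _ => (0 : ℝ) := by
        have ho : IsOpen {r : ℝ | r + τ < tstar / 2} := isOpen_lt (continuous_id.add continuous_const)
          continuous_const
        filter_upwards [ho.mem_nhds hs] with r hr
        rw [hψ0 _ (le_of_lt hr), zero_mul]
      have e0 : (fun y => ψ (z.1 + τ) * V (z.1 + τ) y) = fun _ => (0 : ℝ) := by
        funext y; rw [hψz, zero_mul]
      rw [hevt0.deriv_eq, deriv_const, e0, fderiv_const_apply, InnerProductSpace.laplacian_const]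
      simp
    · have hs' : tstar / 2 ≤ z.1 + τ := not_lt.mp hs
      have hpos : 0 < z.1 + τ := by linarith
      have hmem := hS'cyl z hz hpos
      -- slice facts of `V` at `(z.1 + τ, z.2)`
      have hVs : ContDiffAt ℝ 2 (V (z.1 + τ)) z.2 :=
        contDiffAt_slice_of_contDiffOn hcylopen hV2 (z := (z.1 + τ, z.2)) hmem
      have hVt : HasDerivAt (fun r => V r z.2)
          (fderiv ℝ (uncurry V) (z.1 + τ, z.2) ((1 : ℝ), (0 : EuclideanSpace ℝ (Fin 3)))) (z.1 + τ) :=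
        hasDerivAt_timeLine_of_contDiffOn hcylopen hV2 (by norm_num) (z := (z.1 + τ, z.2)) hmem
      set dV : ℝ := fderiv ℝ (uncurry V) (z.1 + τ, z.2) ((1 : ℝ), (0 : EuclideanSpace ℝ (Fin 3))) with hdV
      have hψd : HasDerivAt ψ (deriv ψ (z.1 + τ)) (z.1 + τ) :=
        ((hψ2.differentiable (by norm_num)) _).hasDerivAt
      have hprod : HasDerivAt (fun r => ψ (r + τ) * V (r + τ) z.2)
          (deriv ψ (z.1 + τ) * V (z.1 + τ) z.2 + ψ (z.1 + τ) * dV) z.1 :=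
        (HasDerivAt.comp_add_const z.1 τ hψd).mul (HasDerivAt.comp_add_const z.1 τ hVt)
      rw [hprod.deriv]
      -- the spatial terms
      have e1 : (fun y => ψ (z.1 + τ) * V (z.1 + τ) y) = ψ (z.1 + τ) • V (z.1 + τ) := by
        funext y; simp only [Pi.smul_apply, smul_eq_mul]
      rw [e1, fderiv_const_smul (hVs.differentiableAt (by norm_num)), InnerProductSpace.laplacian_smul _ hVs]
      have hU1 : U z.1 z.2 = b (z.1 + τ) z.2 := by
        have := (hUev z hz).eq_of_nhds
        rw [this, hφ1 _ hs', one_smul]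
      rw [hU1, FunLike.coe_smul, Pi.smul_apply, smul_eq_mul, smul_eq_mul]
      -- the supersolution inequality of `V`
      have hV := hsupV (z.1 + τ) hmem.1 z.2 hmem.2
      rw [hVt.deriv, real_inner_comm, FluidPDE.inner_gradient_left] at hV
      have hVge : 0 ≤ V (z.1 + τ) z.2 := hV0 _ hmem.1 _ hmem.2
      have e2 : deriv ψ (z.1 + τ) * V (z.1 + τ) z.2 + ψ (z.1 + τ) * dV +
          ψ (z.1 + τ) * (fderiv ℝ (V (z.1 + τ)) z.2) (b (z.1 + τ) z.2) -
          ψ (z.1 + τ) * (Δ (V (z.1 + τ))) z.2 =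
          deriv ψ (z.1 + τ) * V (z.1 + τ) z.2 + ψ (z.1 + τ) *
            (dV - (Δ (V (z.1 + τ))) z.2 + (fderiv ℝ (V (z.1 + τ)) z.2) (b (z.1 + τ) z.2)) := by ring
      rw [e2]
      exact add_nonneg (mul_nonneg (hψ' _) hVge) (mul_nonneg (hψ01 _).1 hV)
  have hclass : NUEnergyClass Φ U k R :=
    nuEnergyClass_of_supersolution k hR h2RR' hΦ2' hU1' hUΛ' hdiv' hsup'
  exact ⟨hk, hR, hΦmeas, hUmeas, hΦcont, hΦ0, Filter.Eventually.of_forall fun t ht => hslice t ht.2,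
    hdriftclass, hclass⟩

end Summit.NavierStokesRegularity.NavierStokesRegularity.Theorems.AveragedConeLiouville.NUPositivity

end
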